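import Literature.NumberTheory.LFunctions.ZetaLogDerivRealBound
import Summits.RiemannHypothesis.RiemannHypothesis.Theorems.JensenLogBandArcMainTerm
import HarnessLib

/-!
# The translated-saddle model: holomorphy, non-vanishing, and its log-derivative at the centre
# ([CMP-ld], near zone via log-derivative transfer)

RH ladder column JENSEN, rung J-P(P3) «log band», BAND crux `XiDerivBandRealAllRates`
(stmt-RiemannHypothesis-19913) of route «JensenLogBand», line «band-one-window» (top-shell reshape,
BAND lead rh-jensen-prover g8), stub `stub_shellNear` — inputs for
`LogBand.LogDerivTransfer.re_logDeriv_ge_of_norm_sub_le` applied to the lead's model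
`LogBandArc.arcShiftModel n v₀ u₀` (`JensenLogBandArcMainTerm.lean`). RH-FREE. WHAT THIS IS NOT:
calculus of an explicit model function; nothing here bears on zeros of `ζ` or the truth of RH.

With `d = u₀ − v₀`, `ũ(v) = d + v`,
`M̃(v) = (n!/2π)·d·γ̃(½+ũ)·2ũ·(d(d+2v))^{−(n+1)}·ζ(½+ũ)·(π/w₀)^{1/2}`:

* `hasDerivAt_arcShiftModel` — `M̃′(v) = M̃(v)·L(v)`,
  `L(v) = γ̃′/γ̃(½+ũ) + 1/ũ − 2(n+1)/(d+2v) + ζ′/ζ(½+ũ)` (where `Re(½+ũ) > 0`, `½+ũ ≠ 1`, `ζ(½+ũ) ≠ 0`,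
  `ũ ≠ 0`, `d ≠ 0`, `d + 2v ≠ 0`);
* `differentiableOn_arcShiftModel`, `arcShiftModel_ne_zero` — holomorphic and zero-free on any ball on
  which `Re(½+ũ) > 1`, `ũ ≠ 0`, `d + 2v ≠ 0` (and `d ≠ 0`, `w₀ ≠ 0`);
* **`logDeriv_arcShiftModel_centre`** — at `v = v₀` with the SADDLE EQUATION `S_{n,v₀}(u₀) = 0`:
  `M̃′(v₀)/M̃(v₀) = n/(u₀−v₀) − (n+1)/(u₀+v₀) + ζ′/ζ(½+u₀)` (the `γ̃`-terms cancel: envelope theorem);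
* **`re_logDeriv_arcShiftModel_centre_ge`** — in regime R2 (`h ≤ 20`) at the own centre `c = x+iT`
  with saddle `u*` and `σ* = Re(½+u*) > 1`:
  `Re(M̃′/M̃)(c) ≥ n·(h−ε)/(h+ε)² − 1/10 − 1/(σ*−1)`, `ε = (2+16h/5)/ℓ_T` (≈ `ℓ_T/2 − 1/(σ*−1)`).

(prover-rh-jensen-eng-2-g6-0, 2026-08-27.)
-/

noncomputable section

-- single-problem summit: `Summit.RiemannHypothesis.RiemannHypothesis.…` is the tree convention
set_option linter.dupNamespace false

open Complex Real Set Metric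

namespace Summit.RiemannHypothesis.RiemannHypothesis.Theorems.JensenPolynomials.LogBandArc

open Literature.NumberTheory.LFunctions

/-! ## The derivative of the shifted model -/

/-- **`M̃′ = M̃·L`.** For `d = u₀ − v₀ ≠ 0` and a point `v` with `ũ = d + v`: `Re(½+ũ) > 0`,
`½+ũ ≠ 1`, `ζ(½+ũ) ≠ 0`, `ũ ≠ 0`, `d + 2v ≠ 0`, the shifted model has derivative
`M̃(v)·(γ̃′/γ̃(½+ũ) + 1/ũ − 2(n+1)/(d+2v) + ζ′/ζ(½+ũ))` at `v`. [folklore] -/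
theorem hasDerivAt_arcShiftModel (n : ℕ) {v₀ u₀ v : ℂ} (hd : u₀ - v₀ ≠ 0)
    (hre : 0 < (1 / 2 + (u₀ - v₀ + v)).re) (h1 : 1 / 2 + (u₀ - v₀ + v) ≠ 1)
    (hζ : riemannZeta (1 / 2 + (u₀ - v₀ + v)) ≠ 0) (hu : u₀ - v₀ + v ≠ 0)
    (h2 : u₀ - v₀ + 2 * v ≠ 0) :
    HasDerivAt (arcShiftModel n v₀ u₀)
      (arcShiftModel n v₀ u₀ v *
        (logDeriv xiGammaFactor (1 / 2 + (u₀ - v₀ + v)) + 1 / (u₀ - v₀ + v) -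
          2 * ((n : ℂ) + 1) / (u₀ - v₀ + 2 * v) +
          deriv riemannZeta (1 / 2 + (u₀ - v₀ + v)) / riemannZeta (1 / 2 + (u₀ - v₀ + v)))) v := by
  set d : ℂ := u₀ - v₀ with hdd
  -- the four moving factors
  have hγ0 : xiGammaFactor (1 / 2 + (d + v)) ≠ 0 := xiGammaFactor_ne_zero hre h1
  have haff : HasDerivAt (fun z : ℂ => 1 / 2 + (d + z)) 1 v := by
    simpa using ((hasDerivAt_id v).const_add d).const_add (1 / 2 : ℂ)
  have hf1 : HasDerivAt (fun z : ℂ => xiGammaFactor (1 / 2 + (d + z)))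
      (xiGammaFactor (1 / 2 + (d + v)) * logDeriv xiGammaFactor (1 / 2 + (d + v))) v := by
    have hd1 := (differentiableAt_xiGammaFactor hre).hasDerivAt
    have hcomp := hd1.comp v haff
    rw [mul_one] at hcomp
    have e : deriv xiGammaFactor (1 / 2 + (d + v)) =
        xiGammaFactor (1 / 2 + (d + v)) * logDeriv xiGammaFactor (1 / 2 + (d + v)) := by
      rw [logDeriv_apply, mul_div_assoc', mul_div_cancel_left₀ _ hγ0]
    rw [← e]; exact hcomp
  have hf2 : HasDerivAt (fun z : ℂ => 2 * (d + z)) 2 v := by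
    simpa using ((hasDerivAt_id v).const_add d).const_mul (2 : ℂ)
  have hb : HasDerivAt (fun z : ℂ => d * (d + 2 * z)) (2 * d) v := by
    have := (((hasDerivAt_id v).const_mul (2 : ℂ)).const_add d).const_mul d
    simpa [mul_comm] using this
  have hbne : d * (d + 2 * v) ≠ 0 := mul_ne_zero hd h2
  have hbpow : HasDerivAt (fun z : ℂ => (d * (d + 2 * z)) ^ (n + 1))
      (((n + 1 : ℕ) : ℂ) * (d * (d + 2 * v)) ^ n * (2 * d)) v := hb.pow (n + 1)
  have hpow_ne : (d * (d + 2 * v)) ^ (n + 1) ≠ 0 := pow_ne_zero _ hbne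
  have hf3 : HasDerivAt (fun z : ℂ => ((d * (d + 2 * z)) ^ (n + 1))⁻¹)
      (((d * (d + 2 * v)) ^ (n + 1))⁻¹ * (-(2 * ((n : ℂ) + 1)) / (d + 2 * v))) v := by
    have hinv := hbpow.inv hpow_ne
    have e : -(((n + 1 : ℕ) : ℂ) * (d * (d + 2 * v)) ^ n * (2 * d)) / ((d * (d + 2 * v)) ^ (n + 1)) ^ 2 =
        ((d * (d + 2 * v)) ^ (n + 1))⁻¹ * (-(2 * ((n : ℂ) + 1)) / (d + 2 * v)) := by
      push_cast
      field_simp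
      ring
    rw [← e]; exact hinv
  have hf4 : HasDerivAt (fun z : ℂ => riemannZeta (1 / 2 + (d + z)))
      (riemannZeta (1 / 2 + (d + v)) *
        (deriv riemannZeta (1 / 2 + (d + v)) / riemannZeta (1 / 2 + (d + v)))) v := by
    have hd4 := (differentiableAt_riemannZeta h1).hasDerivAt
    have hcomp := hd4.comp v haff
    rw [mul_one] at hcomp
    have e : deriv riemannZeta (1 / 2 + (d + v)) = riemannZeta (1 / 2 + (d + v)) *
        (deriv riemannZeta (1 / 2 + (d + v)) / riemannZeta (1 / 2 + (d + v))) := by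
      rw [mul_div_assoc', mul_div_cancel_left₀ _ hζ]
    rw [← e]; exact hcomp
  -- the product
  set P : ℂ := ((π : ℂ) / arcCurv n v₀ u₀) ^ (1 / 2 : ℂ) with hP
  set C : ℂ := (n.factorial : ℂ) / (2 * π) with hC
  have hprod := ((((hf1.mul (hf2.mul hf3)).const_mul d).mul hf4).mul_const P).const_mul C
  have hfun : arcShiftModel n v₀ u₀ = fun z : ℂ => C * ((d * (xiGammaFactor (1 / 2 + (d + z)) *
      (2 * (d + z) * ((d * (d + 2 * z)) ^ (n + 1))⁻¹))) * riemannZeta (1 / 2 + (d + z)) * P) := by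
    funext z; rw [arcShiftModel_eq]
  rw [hfun]
  refine hprod.congr_deriv ?_
  -- identify the derivative with `M̃(v)·L(v)`
  have hdv : d + v ≠ 0 := hu
  simp only [Pi.mul_apply]
  -- make the two log-derivatives opaque atoms, then clear the rational denominators
  generalize hq : deriv riemannZeta (1 / 2 + (d + v)) / riemannZeta (1 / 2 + (d + v)) = q
  generalize hg : logDeriv xiGammaFactor (1 / 2 + (d + v)) = g
  generalize hZ : riemannZeta (1 / 2 + (d + v)) = Z
  generalize hG : xiGammaFactor (1 / 2 + (d + v)) = G
  field_simp
  ring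

/-! ## Holomorphy and non-vanishing on a ball -/

/-- **The shifted model is holomorphic** on any ball about `v₀` on which `Re(½+ũ) > 1`, `ũ ≠ 0`,
`d + 2v ≠ 0` (`d = u₀ − v₀ ≠ 0`). [folklore] -/
theorem differentiableOn_arcShiftModel (n : ℕ) {v₀ u₀ : ℂ} {R : ℝ} (hd : u₀ - v₀ ≠ 0)
    (hball : ∀ v ∈ ball v₀ R, 1 < (1 / 2 + (u₀ - v₀ + v)).re ∧ u₀ - v₀ + v ≠ 0 ∧
      u₀ - v₀ + 2 * v ≠ 0) :
    DifferentiableOn ℂ (arcShiftModel n v₀ u₀) (ball v₀ R) := by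
  intro v hv
  obtain ⟨hre1, hu, h2⟩ := hball v hv
  have hre : 0 < (1 / 2 + (u₀ - v₀ + v)).re := by linarith
  have h1 : 1 / 2 + (u₀ - v₀ + v) ≠ 1 := by
    intro h; rw [h] at hre1; simp at hre1
  have hζ : riemannZeta (1 / 2 + (u₀ - v₀ + v)) ≠ 0 := riemannZeta_ne_zero_of_one_lt_re hre1
  exact (hasDerivAt_arcShiftModel n hd hre h1 hζ hu h2).differentiableAt.differentiableWithinAt

/-- **The shifted model is zero-free** at any point with `Re(½+ũ) > 1`, `ũ ≠ 0`, `d + 2v ≠ 0`,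
provided `d ≠ 0` and the frozen curvature `w₀ ≠ 0`. [folklore] -/
theorem arcShiftModel_ne_zero (n : ℕ) {v₀ u₀ v : ℂ} (hd : u₀ - v₀ ≠ 0) (hw : arcCurv n v₀ u₀ ≠ 0)
    (hre1 : 1 < (1 / 2 + (u₀ - v₀ + v)).re) (hu : u₀ - v₀ + v ≠ 0) (h2 : u₀ - v₀ + 2 * v ≠ 0) :
    arcShiftModel n v₀ u₀ v ≠ 0 := by
  have hre : 0 < (1 / 2 + (u₀ - v₀ + v)).re := by linarith
  have h1 : 1 / 2 + (u₀ - v₀ + v) ≠ 1 := by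
    intro h; rw [h] at hre1; simp at hre1
  have hζ : riemannZeta (1 / 2 + (u₀ - v₀ + v)) ≠ 0 := riemannZeta_ne_zero_of_one_lt_re hre1
  have hγ : xiGammaFactor (1 / 2 + (u₀ - v₀ + v)) ≠ 0 := xiGammaFactor_ne_zero hre h1
  have hP : ((π : ℂ) / arcCurv n v₀ u₀) ^ (1 / 2 : ℂ) ≠ 0 := by
    rw [Ne, Complex.cpow_eq_zero_iff, not_and_or]
    left
    exact div_ne_zero (by exact_mod_cast Real.pi_ne_zero) hw
  have hC : (n.factorial : ℂ) / (2 * π) ≠ 0 := by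
    apply div_ne_zero (by exact_mod_cast (Nat.factorial_ne_zero n))
    exact mul_ne_zero two_ne_zero (by exact_mod_cast Real.pi_ne_zero)
  have hpow : ((u₀ - v₀) * (u₀ - v₀ + 2 * v)) ^ (n + 1) ≠ 0 := pow_ne_zero _ (mul_ne_zero hd h2)
  rw [arcShiftModel_eq]
  exact mul_ne_zero hC (mul_ne_zero (mul_ne_zero (mul_ne_zero hd (mul_ne_zero hγ
    (mul_ne_zero (mul_ne_zero two_ne_zero hu) (inv_ne_zero hpow)))) hζ) hP)

/-! ## The log-derivative at the centre: the envelope theorem -/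

/-- **`M̃′/M̃` at the centre, via the saddle equation.** If `S_{n,v₀}(u₀) = 0` (and the
non-degeneracy conditions at `v₀`: `Re(½+u₀) > 0`, `½+u₀ ≠ 1`, `ζ(½+u₀) ≠ 0`, `u₀ ≠ 0`,
`u₀ − v₀ ≠ 0`, `u₀ + v₀ ≠ 0`), then
`deriv M̃ v₀ / M̃ v₀ = n/(u₀ − v₀) − (n+1)/(u₀ + v₀) + ζ′/ζ(½+u₀)` (as long as `M̃(v₀) ≠ 0`).
[folklore] -/
theorem logDeriv_arcShiftModel_centre (n : ℕ) {v₀ u₀ : ℂ} (hd : u₀ - v₀ ≠ 0)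
    (hre : 0 < (1 / 2 + u₀).re) (h1 : 1 / 2 + u₀ ≠ 1) (hζ : riemannZeta (1 / 2 + u₀) ≠ 0)
    (hu : u₀ ≠ 0) (hupv : u₀ + v₀ ≠ 0) (hM : arcShiftModel n v₀ u₀ v₀ ≠ 0)
    (hS : arcSaddleFn n v₀ u₀ = 0) :
    deriv (arcShiftModel n v₀ u₀) v₀ / arcShiftModel n v₀ u₀ v₀ =
      (n : ℂ) / (u₀ - v₀) - ((n : ℂ) + 1) / (u₀ + v₀) +
        deriv riemannZeta (1 / 2 + u₀) / riemannZeta (1 / 2 + u₀) := by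
  have e0 : u₀ - v₀ + v₀ = u₀ := by ring
  have e2 : u₀ - v₀ + 2 * v₀ = u₀ + v₀ := by ring
  have hD := hasDerivAt_arcShiftModel n (v := v₀) hd (by rw [e0]; exact hre) (by rw [e0]; exact h1)
    (by rw [e0]; exact hζ) (by rw [e0]; exact hu) (by rw [e2]; exact hupv)
  rw [hD.deriv, e0, e2, mul_div_cancel_left₀ _ hM]
  -- the saddle equation: `γ̃′/γ̃(½+u₀) + 1/u₀ = n/(u₀−v₀) + (n+1)/(u₀+v₀)`
  have hS' : logDeriv xiGammaFactor (1 / 2 + u₀) + 1 / u₀ =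
      (n : ℂ) / (u₀ - v₀) + ((n : ℂ) + 1) / (u₀ + v₀) := by
    rw [arcSaddleFn] at hS
    linear_combination hS
  linear_combination hS'

/-- **The real part of `M̃′/M̃` at the own centre (regime R2).** Own centre `c = x + iT`, saddle `u*`
(S3 disc, `S = 0`), `σ* = Re(½+u*) > 1`, `h = h(n,T) ≤ 20`, `ε = (2+16h/5)/ℓ_T`; if `M̃(c) ≠ 0`:
`Re(deriv M̃ c / M̃ c) ≥ n·(h − ε)/(h + ε)² − 1/10 − 1/(σ* − 1)` — i.e. `≈ ℓ_T/2 − 1/(σ*−1)`, the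
input `(deriv M v₀ / M v₀).re` of the log-derivative transfer. [folklore] -/
theorem re_logDeriv_arcShiftModel_centre_ge {n : ℕ} {x T : ℝ} {u : ℂ} (hx : |x| ≤ 1 / 2)
    (hT : 100 ≤ T) (hℓ : 20 ≤ ell T) (hn : 100 ≤ n) (hh : 1 / 2 ≤ bandRadius n T)
    (hhT : bandRadius n T ≤ 7 / 20 * T) (hH : bandRadius n T ≤ 20)
    (hu : ‖u - ((x : ℂ) + (T : ℂ) * I + bandRadius n T)‖ ≤ 3 / 5 * bandRadius n T)
    (hS : arcSaddleFn n ((x : ℂ) + (T : ℂ) * I) u = 0) (hσ : 1 < (1 / 2 + u).re)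
    (hM : arcShiftModel n ((x : ℂ) + (T : ℂ) * I) u ((x : ℂ) + (T : ℂ) * I) ≠ 0) :
    (n : ℝ) * ((bandRadius n T - (2 + 16 / 5 * bandRadius n T) / ell T) /
        (bandRadius n T + (2 + 16 / 5 * bandRadius n T) / ell T) ^ 2) - 1 / 10 -
        1 / ((1 / 2 + u).re - 1) ≤
      (deriv (arcShiftModel n ((x : ℂ) + (T : ℂ) * I) u) ((x : ℂ) + (T : ℂ) * I) /
        arcShiftModel n ((x : ℂ) + (T : ℂ) * I) u ((x : ℂ) + (T : ℂ) * I)).re := by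
  obtain ⟨-, hεh, hε33, hT1200, hnT⟩ := R2_bookkeeping hT hℓ hh hH
  obtain ⟨hre_lo, him_abs, hr_lo, hr_hi⟩ := arcSaddle_sharp_polar hx hT hℓ hn hh hhT hH hu hS
  have hcim : ((x : ℂ) + (T : ℂ) * I).im = T := by simp
  have hcre : ((x : ℂ) + (T : ℂ) * I).re = x := by simp
  have hx1 := abs_le.1 hx
  have him := abs_le.1 him_abs
  -- non-degeneracy at the centre
  have hre0 : 0 < (1 / 2 + u).re := by linarith
  have h1 : 1 / 2 + u ≠ 1 := by intro h; rw [h] at hσ; simp at hσ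
  have hζ : riemannZeta (1 / 2 + u) ≠ 0 := riemannZeta_ne_zero_of_one_lt_re hσ
  have hd : u - ((x : ℂ) + (T : ℂ) * I) ≠ 0 := by
    intro h0; rw [h0] at hre_lo; simp at hre_lo; linarith
  have huim : T - 33 / 10 ≤ u.im := by
    have e : u.im = (u - ((x : ℂ) + (T : ℂ) * I)).im + T := by rw [Complex.sub_im, hcim]; ring
    rw [e]; linarith
  have hu0 : u ≠ 0 := by
    intro h0; rw [h0] at huim; simp at huim; linarith
  have hupc_im : 2 * T - 33 / 10 ≤ (u + ((x : ℂ) + (T : ℂ) * I)).im := by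
    have e : (u + ((x : ℂ) + (T : ℂ) * I)).im = (u - ((x : ℂ) + (T : ℂ) * I)).im + 2 * T := by
      rw [Complex.add_im, Complex.sub_im, hcim]; ring
    rw [e]; linarith
  have hupc : u + ((x : ℂ) + (T : ℂ) * I) ≠ 0 := by
    intro h0; rw [h0] at hupc_im; simp at hupc_im; linarith
  rw [logDeriv_arcShiftModel_centre n hd hre0 h1 hζ hu0 hupc hM hS]
  -- the three real parts
  generalize hε' : (2 + 16 / 5 * bandRadius n T) / ell T = ε at *
  generalize hh' : bandRadius n T = h at *
  generalize hc : ((x : ℂ) + (T : ℂ) * I) = c at *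
  have hh0 : 0 < h := by linarith
  have hε0 : 0 ≤ ε := (abs_nonneg _).trans him_abs
  set dd : ℂ := u - c with hdd
  have hdre : h - ε ≤ dd.re := hre_lo
  have hdnorm_hi : ‖dd‖ ≤ h + ε := hr_hi
  have hdnorm_lo : h - ε ≤ ‖dd‖ := hr_lo
  have hdpos : 0 < ‖dd‖ := by linarith
  -- (1) `Re(n/dd) = n·Re dd/‖dd‖² ≥ n(h−ε)/(h+ε)²`
  have h1re : (n : ℝ) * ((h - ε) / (h + ε) ^ 2) ≤ ((n : ℂ) / dd).re := by
    have e : ((n : ℂ) / dd).re = (n : ℝ) * dd.re / ‖dd‖ ^ 2 := by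
      rw [Complex.div_re, Complex.natCast_re, Complex.natCast_im, Complex.normSq_eq_norm_sq]
      ring
    rw [e, mul_div_assoc]
    apply mul_le_mul_of_nonneg_left _ (by positivity)
    -- `(h−ε)/(h+ε)² ≤ Re dd/‖dd‖²`
    have hpos1 : 0 < (h + ε) ^ 2 := by positivity
    have hpos2 : 0 < ‖dd‖ ^ 2 := by positivity
    rw [div_le_div_iff₀ hpos1 hpos2]
    have hsq : ‖dd‖ ^ 2 ≤ (h + ε) ^ 2 := pow_le_pow_left₀ hdpos.le hdnorm_hi 2
    have hre_nn : 0 ≤ h - ε := by linarith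
    calc (h - ε) * ‖dd‖ ^ 2 ≤ (h - ε) * (h + ε) ^ 2 := mul_le_mul_of_nonneg_left hsq hre_nn
      _ ≤ dd.re * (h + ε) ^ 2 := mul_le_mul_of_nonneg_right hdre hpos1.le
  -- (2) `|Re((n+1)/(u+c))| ≤ (n+1)/‖u+c‖ ≤ (T/6)/(2T − 4) ≤ 1/10`
  have h2re : |(((n : ℂ) + 1) / (u + c)).re| ≤ 1 / 10 := by
    have hn1 : ‖((n : ℂ) + 1) / (u + c)‖ ≤ 1 / 10 := by
      rw [norm_div, show ((n : ℂ) + 1) = (((n : ℝ) + 1 : ℝ) : ℂ) by push_cast; ring, Complex.norm_real,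
        Real.norm_eq_abs, abs_of_pos (by positivity)]
      have hupc_norm : 2 * T - 33 / 10 ≤ ‖u + c‖ := by
        have := Complex.abs_im_le_norm (u + c)
        rw [abs_of_pos (by linarith)] at this; linarith
      rw [div_le_div_iff₀ (by linarith) (by norm_num)]
      nlinarith
    exact (Complex.abs_re_le_norm _).trans hn1
  have h2re' := abs_le.1 h2re
  -- (3) `Re(ζ′/ζ) ≥ −‖ζ′/ζ‖ > −1/(σ*−1)`
  have h3 := norm_deriv_riemannZeta_div_lt hσ
  have h3re : -(1 / ((1 / 2 + u).re - 1)) ≤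
      (deriv riemannZeta (1 / 2 + u) / riemannZeta (1 / 2 + u)).re := by
    have := (abs_le.1 ((Complex.abs_re_le_norm (deriv riemannZeta (1 / 2 + u) /
      riemannZeta (1 / 2 + u))).trans h3.le)).1
    linarith
  have hsplit : ((n : ℂ) / (u - c) - ((n : ℂ) + 1) / (u + c) +
      deriv riemannZeta (1 / 2 + u) / riemannZeta (1 / 2 + u)).re =
      ((n : ℂ) / (u - c)).re - (((n : ℂ) + 1) / (u + c)).re +
        (deriv riemannZeta (1 / 2 + u) / riemannZeta (1 / 2 + u)).re := by
    simp only [Complex.add_re, Complex.sub_re]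
  rw [hsplit]
  linarith [h1re, h2re'.2, h3re]

end Summit.RiemannHypothesis.RiemannHypothesis.Theorems.JensenPolynomials.LogBandArc

end
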